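import Literature.MathematicalPhysics.QuantumFieldTheory.Balaban1983to89.Beta.RemainderDecay190TwoGrid
import Literature.MathematicalPhysics.QuantumFieldTheory.Balaban1983to89.Beta.RemainderDecay190TwoGridHkLimit
import Literature.MathematicalPhysics.QuantumFieldTheory.Balaban1983to89.B6MainResultsOneLevel
import Literature.MathematicalPhysics.QuantumFieldTheory.Balaban1983to89.B5Hk163TorusHolderDecay

/-!
# [Balaban1987RG1] (4.4) p. 281 ∕ p. 282 ⟵ [Balaban1984PropagatorsII] Cor. 2.8 (2.151), THREE ENTRIES: NODE D and NODE E of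
row (D4) inhabited by Bałaban's flat `H_k` WITH THE VALUE, GRADIENT AND HÖLDER ENTRIES of (190) ∕ (4.4)
(`Beta.RemainderDecay190TwoGridHkHolder`)

statement-level skeleton of published theorems with citation tags; proofs where landed; nothing here is a claim
about the Yang–Mills mass gap.

HONEST FRAMING (cell rule, page 1 of everything).  Discharging `BetaPertH` makes Bałaban's UV stability UNCONDITIONAL —
a real constructive-QFT result; it is NOT the continuum limit and NOT the Clay problem.  This module discharges NOTHING
of `BetaPertH`.  Bookkeeping for the k-uniform remainder chain of row (D4) (`RemainderConst` ⇐ ONE `ChainTFac190`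
instance, `Beta.RemainderDecay190`).  Unit `b2b-balaban-beta-an4` gen 102 (BINDER row D4 OWNER; cell pub-balaban).
Imports `Beta.RemainderDecay190TwoGrid` (generation 101: the two-grid join certificate),
`Beta.RemainderDecay190TwoGridHkLimit` (this generation: the entrywise volume limits), `B6MainResultsOneLevel` (the
(2.151) entries of `H_k` BY NAME) and `B5Hk163TorusHolderDecay` (the typed `∂_νH_k`, its kernel `dker`, the decaying
Hölder letter `norm_dker_sub_le_decay'` and the kernel dictionary `dgker_toT_eq_torusKernel`) ONLY; nothing edited.
(Generation 101's value-only instance `Beta.RemainderDecay190TwoGridHk` is NOT imported — it sits in the olean lane at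
the time of writing; its small carrier helpers are re-proved here as private lemmas.)

WHAT.  The (4.4)-norm of [I] p. 281 and the list (190) of [15] p. 308 carry, besides the VALUE `sup|𝓗|` and the
GRADIENT `sup|∇^η𝓗|`, the HÖLDER entry `‖ζ∇𝓗‖_β` (the `β`-Hölder quotient of `∇𝓗` inside the blocks).  Every
instance of the road so far reads ONE sup size (the value); this file supplies the flat `H_k` with ALL THREE first entries
WITHOUT a new definition, by reading a configuration on the EXTENDED carrier
`XA n := (T₁(n) × Fin D) × Entry`, `Entry := (Fin D → Fin nm) ⊕ ((Fin D → Fin nm) × Fin D) ⊕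
(((Fin D → Fin nm) × (Fin D → Fin nm)) × Fin D)` — at `((y, μ), inl a)` the VALUE `(H_kB)_μ(nm·y + a)`, at
`((y, μ), inr (inl (a, ν)))` the FORWARD DERIVATIVE `(∂^η_νH_kB)_μ(nm·y + a)`, at `((y, μ), inr (inr ((a₁, a₂), ν)))` the
HÖLDER QUOTIENT `((∂^η_νH_kB)_μ(nm·y + a₂) − (∂^η_νH_kB)_μ(nm·y + a₁))·|η(a₂ − a₁)|^{−α}` of two fine points of the
SAME unit block (`|η(a₂ − a₁)| = ‖a₂ − a₁‖₂∕nm`; pairs with `a₁ = a₂` read `0`) — so that the sup norm of `XA n → ℂ` IS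
`max(sup|A|, max_ν sup|∂_νA|, max_ν sup_{x₁ ≠ x₂ same block}|∂_νA(x₂) − ∂_νA(x₁)|∕|x₂ − x₁|^α)` and generation 101's
join certificate `RemainderDecay190TwoGrid.exists_data190_twoGrid_of_rowMajorant` applies verbatim to the extended
operator (the matrix with entries `hker` ∕ `dker` ∕ weighted `dker`-differences, displayed inline):
* §1 helpers (private copies of generation 101's carrier lemmas; `CH1_nonneg`, `CHD_nonneg`, the pair displacement
  `bpt_eq_bpt_add_toT`, the rate conversion `exp_rate_distSite_le_exp_pl1`).
* §2 **`rowMajorant_HkOpC1a`** — for `0 ≤ α < 1`: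
  `‖(extended column)((y,μ),e)‖ ≤ Σ_{(c,λ)} Cα(D,α)·e^{−(ρα(D,α)∕D)‖y − c‖}·‖B_λ(c)‖`,
  `Cα = max(max(CH0,CH1), CHD(d,α))`, `ρα = rateH(D)·(1−α)∕(1+α)` — [3] (2.151) first and second entries
  (`B6MainResultsOneLevel.norm_HkOp_bpt_le` ∕ `norm_dker_bpt_le'`) and the decaying Hölder letter
  `B5Hk163TorusHolderDecay.norm_dker_sub_le_decay'` (third entry; the factor `(‖z‖₂∕nm)^α` CANCELS the weight exactly),
  all mesh-uniform and dimension-only, BY NAME.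
* §3 **`exists_data190_twoGrid_HkOpC1a`**, **`exists_consts190_twoGrid_HkOpC1a`** — NODE D's socket inhabited on the
  extended carrier with ONE explicit `q⋆α(D, M, α)`, `q⋆α.Valid (ρα∕D∕(4M))`, for EVERY mesh, volume sequence, direction.
* §4 **`tendsto_entryC1a_cubes`**, **`hconv_twoGrid_HkOpC1a_of_rule`**, **`exists_data190_hconv_twoGrid_HkOpC1a`** —
  NODE E on the extended carrier (the kernels of `H_k`, `∂_νH_k` and their weighted same-block differences converge
  entrywise to the infinite-lattice kernels `latticeKernel G_a`, `latticeKernel D_{ν,a}`; §2 of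
  `RemainderDecay190TwoGridHkLimit`) and NODE D ∧ NODE E jointly.
HONEST: the Hölder quotient is read over pairs of the SAME unit block `Δ(y)` (print: the enlarged block `Δ̃(y)`) and
without the cut-off `ζ`; the second-order entries `|D*D(δ𝓗)|`, `|Δ(δ𝓗)|` of (190) are NOT here; the scale weights
`(L^jη)^{−1}, (L^jη)^{−2}, (L^jη)^{−2−β}` are constants at one scale and are not displayed; zero background, flat, one
scale of M-cubes — the `H₀`-LETTER of [15] (182), NOT the (182) derivative in a background (nor at zero background for
`k ≥ 1`, where the Hessian of the accumulated effective action enters through (184)), NOT (189)∕(181), NOT the RG-flow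
instance.  Row D4 class UNCHANGED (instance 0∕1; D4 DISCHARGE NO DATE).  No `def`, no named fact, no `sorry`, standard
axioms.  NOT B12 Thm 2, NOT BetaPertH, NOT the continuum limit, NOT Clay.
HONEST DEPENDENCY: continuum YM on T⁴ ⇐ BetaPertH ∧ nine spine estimates (0/9 proved); BetaPertH ⇐ (D1) ∧ (D4) ∧
CAP+tail; G-an2-4 gates asym, D1 and NE2/3/4.

Sources: [I] = T. Bałaban, Commun. Math. Phys. **109** (1987) 249–301 [Balaban1987RG1], (4.4) p. 281, p. 282, (4.35)
p. 290, (1.21) p. 264; [B5] = Commun. Math. Phys. **95** (1984) 17–40 [Balaban1984PropagatorsI], (1.63) p. 28, p. 29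
lines 1–2 (*"This implies bounds on (1/|x′−x|^α)|∂_ν(H_kB)_μ(x′) − ∂_ν(H_kB)_μ(x)|"*), (1.31) p. 23, p. 36; [3] =
Commun. Math. Phys. **96** (1984) 223–250 [Balaban1984PropagatorsII], Cor. 2.8 (2.150)–(2.151) p. 249; [15] = Commun.
Math. Phys. **102** (1985) 277–309 [Balaban1985Variational], (190) p. 308.  Locations only; the mathematics is the tree's
`B5Hk163Torus*` ∕ `B6MainResultsOneLevel` BY NAME.
-/

namespace Literature.MathematicalPhysics.QuantumFieldTheory.Balaban1983to89.Beta.RemainderDecay190TwoGridHkHolder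

open Literature.MathematicalPhysics.QuantumFieldTheory.Balaban1983to89 B11SectG
open Literature.MathematicalPhysics.QuantumFieldTheory.Balaban1983to89.B4ContourShift (latticeKernel)
open Literature.MathematicalPhysics.QuantumFieldTheory.Balaban1983to89.B4TorusKernel.MultiPeriod (torusSupNorm)
open Literature.MathematicalPhysics.QuantumFieldTheory.Balaban1983to89.TreeLengthTorus (TPt TDom proj)
open Literature.MathematicalPhysics.QuantumFieldTheory.Balaban1983to89.B12Decay510Window (K₁ K₁_nonneg)
open Literature.MathematicalPhysics.QuantumFieldTheory.Balaban1983to89.B12Decay510Torus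
  (pabs pabs_eq_natAbs pl1 pl1_eq_sum tcubeOf)
open Literature.MathematicalPhysics.QuantumFieldTheory.Balaban1983to89.B12Decay510Lattice (cubeOf)
open Literature.MathematicalPhysics.QuantumFieldTheory.Balaban1983to89.B13ScaleTransfer (Pt)
open Literature.MathematicalPhysics.QuantumFieldTheory.Balaban1983to89.B5Prop11Plancherel (Tor fine fdiff)
open Literature.MathematicalPhysics.QuantumFieldTheory.Balaban1983to89.B5Prop12FieldsLattice (distSite distSite_nonneg)
open Literature.MathematicalPhysics.QuantumFieldTheory.Balaban1983to89.B5Block118 (bpt up iota)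
open Literature.MathematicalPhysics.QuantumFieldTheory.Balaban1983to89.B5Hk163Torus (HkOp HkOp_mulVec hker)
open Literature.MathematicalPhysics.QuantumFieldTheory.Balaban1983to89.B5Hk163TorusHolder
  (zlen zlen_nonneg zlen_pos dker fdiff_HkOp_mulVec CHolderTorus)
open Literature.MathematicalPhysics.QuantumFieldTheory.Balaban1983to89.B5Hk163TorusHolderDecay
  (D163 stripRegular_D163 dgker_toT_eq_torusKernel dker_bpt CdecD CdecD_nonneg CHD CHolderTorus_nonneg
    norm_dker_sub_le_decay')
open Literature.MathematicalPhysics.QuantumFieldTheory.Balaban1983to89.B5Hk163Decay (G163)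
open Literature.MathematicalPhysics.QuantumFieldTheory.Balaban1983to89.B5Hk163Strip (kappa163 kappa163_pos)
open Literature.MathematicalPhysics.QuantumFieldTheory.Balaban1983to89.B5Kernel166Decay (toT_sub)
open Literature.MathematicalPhysics.QuantumFieldTheory.Balaban1983to89.B6LowerBound2153Torus (toT rep toT_rep)
open Literature.MathematicalPhysics.QuantumFieldTheory.Balaban1983to89.B5Ineq110P12Lattice (distSite_eq_torusSupNorm)
open Literature.MathematicalPhysics.QuantumFieldTheory.Balaban1983to89.B6MainResultsOneLevel
  (CH0 CH1 rateH EH norm_HkOp_bpt_le norm_dker_bpt_le')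
open Literature.MathematicalPhysics.QuantumFieldTheory.Balaban1983to89.Beta.RemainderLimitTorus (LDom tproj)
open Literature.MathematicalPhysics.QuantumFieldTheory.Balaban1983to89.Beta.RemainderDecay190 (Data190 Consts190)
open Literature.MathematicalPhysics.QuantumFieldTheory.Balaban1983to89.Beta.RemainderDecay190TwoGrid
  (exists_data190_twoGrid_of_rowMajorant)
open Literature.MathematicalPhysics.QuantumFieldTheory.Balaban1983to89.Beta.RemainderDecay190TwoGridHkLimit
  (tendsto_torusKernel_descend tendsto_hker_bpt_cubes)
open Literature.MathematicalPhysics.QuantumFieldTheory.Balaban1983to89.Beta.RemainderDecay190SupNormLimit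
  (tcubeOf_proj_mem_tproj)
open Filter
open scoped Topology Matrix

noncomputable section

variable {d : ℕ}

/-! ## 1. Helpers: constants, the pair displacement, the rate conversion -/

section Helpers

/-- (private copy of generation 101's `RemainderDecay190TwoGridHk.pl1_sub_le_mul_distSite`) ℓ¹ ≤ D × ℓ^∞ on the cubic
torus. [cite: Balaban1984PropagatorsI, (1.110) p.35; Balaban1984PropagatorsII, (2.46) p.231] -/
private theorem pl1_sub_le_mul_distSite (s : ℕ) [NeZero s] (y c : Tor (fun _ : Fin (d + 1) => s)) :
    pl1 (y - c) ≤ ((d : ℝ) + 1) * distSite (fun _ : Fin (d + 1) => s) y c := by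
  rw [pl1_eq_sum]
  have h : ∀ i : Fin (d + 1), (pabs ((y - c) i) : ℝ) ≤ distSite (fun _ : Fin (d + 1) => s) y c := fun i => by
    rw [pabs_eq_natAbs, Pi.sub_apply]
    unfold distSite
    have hle : ((y i - c i).valMinAbs).natAbs ≤
        Finset.univ.sup (fun μ : Fin (d + 1) => ((y μ - c μ).valMinAbs).natAbs) :=
      Finset.le_sup (f := fun μ : Fin (d + 1) => ((y μ - c μ).valMinAbs).natAbs) (Finset.mem_univ i)
    exact_mod_cast hle
  calc ∑ i : Fin (d + 1), (pabs ((y - c) i) : ℝ)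
      ≤ ∑ _i : Fin (d + 1), distSite (fun _ : Fin (d + 1) => s) y c := Finset.sum_le_sum fun i _ => h i
    _ = ((d : ℝ) + 1) * distSite (fun _ : Fin (d + 1) => s) y c := by
        rw [Finset.sum_const, Finset.card_univ, Fintype.card_fin, nsmul_eq_mul]; push_cast; ring

/-- (private copy of generation 101's `card_fibre_fst`) the fibre of `Prod.fst` over a point has `card β` elements.
[cite: Balaban1984PropagatorsII, (2.150) p.249] [folklore] -/
private theorem card_fibre_fst {α β : Type} [Fintype α] [Fintype β] [DecidableEq α] (y : α) :
    (Finset.univ.filter fun b : α × β => b.1 = y).card = Fintype.card β := by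
  have h : (Finset.univ.filter fun b : α × β => b.1 = y) = ({y} : Finset α) ×ˢ (Finset.univ : Finset β) := by
    ext ⟨a, b⟩
    simp [eq_comm]
  rw [h, Finset.card_product, Finset.card_singleton, one_mul, Finset.card_univ]

/-- (private copy of generation 101's `CH0_nonneg`) `0 ≤ CH0 D`. [cite: Balaban1984PropagatorsII, Cor. 2.8 (2.151) p.249] -/
private theorem CH0_nonneg (d : ℕ) : 0 ≤ CH0 (d + 1) := by
  have h := norm_HkOp_bpt_le 1 (fun _ : Fin (d + 1) => 1) 0 0 (fun _ => 0) 0 0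
  have hE : 0 < EH (fun _ : Fin (d + 1) => 1) 0 0 := Real.exp_pos _
  have h0 : 0 * EH (fun _ : Fin (d + 1) => 1) 0 0 ≤ CH0 (d + 1) * EH (fun _ : Fin (d + 1) => 1) 0 0 := by
    rw [zero_mul]; exact (norm_nonneg _).trans h
  exact le_of_mul_le_mul_right h0 hE

/-- `0 ≤ CH1 D` (the sup constant of `|∂_νH(b,c)|`, [3] (2.151) second entry; read off
`B6MainResultsOneLevel.norm_dker_bpt_le'` on the one-point torus). [cite: Balaban1984PropagatorsII, Cor. 2.8 (2.151) p.249] -/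
theorem CH1_nonneg (d : ℕ) : 0 ≤ CH1 (d + 1) := by
  have h := norm_dker_bpt_le' 1 (fun _ : Fin (d + 1) => 1) 0 0 (fun _ => 0) 0 0 0
  have hE : 0 < EH (fun _ : Fin (d + 1) => 1) 0 0 := Real.exp_pos _
  have h0 : 0 * EH (fun _ : Fin (d + 1) => 1) 0 0 ≤ CH1 (d + 1) * EH (fun _ : Fin (d + 1) => 1) 0 0 := by
    rw [zero_mul]; exact (norm_nonneg _).trans h
  exact le_of_mul_le_mul_right h0 hE

/-- `0 ≤ CHD(d, α)` for `0 ≤ α < 1` (the constant of the decaying Hölder letter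
`B5Hk163TorusHolderDecay.norm_dker_sub_le_decay'`). [cite: Balaban1984PropagatorsI, p.29 lines 1–2] [folklore] -/
theorem CHD_nonneg (d : ℕ) {α : ℝ} (hα0 : 0 ≤ α) (hα1 : α < 1) : 0 ≤ CHD d α := by
  unfold CHD
  have h1 : 0 ≤ CHolderTorus (d + 1) ((1 + α) / 2) :=
    CHolderTorus_nonneg (0 : Fin (d + 1)) (by linarith) (by linarith)
  have h2 : 0 ≤ 2 * CdecD d := by have := CdecD_nonneg (d := d); linarith
  exact mul_nonneg (Real.rpow_nonneg h1 _) (Real.rpow_nonneg h2 _)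

/-- **The rate `rateH(D)` is `κ₁₆₃(D)∕D`** written with the real successor. [folklore]
[cite: Balaban1984PropagatorsII, Cor. 2.8 (2.151) p.249] -/
theorem rateH_succ_eq (d : ℕ) : rateH (d + 1) = kappa163 (d + 1) / ((d : ℝ) + 1) := by
  unfold rateH; push_cast; ring

/-- `0 < rateH D` for `D = d + 1`. [cite: Balaban1984PropagatorsII, Cor. 2.8 (2.151) p.249] [folklore] -/
theorem rateH_pos (d : ℕ) : 0 < rateH (d + 1) := by
  rw [rateH_succ_eq]; exact div_pos (kappa163_pos _) (by positivity)

/-- **Rate conversion** on the cubic unit torus: for every rate `r ≥ 0`,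
`e^{−r·distSite(y,c)} ≤ e^{−(r∕D)·‖y − c‖}` (`‖·‖` the road's periodic ℓ¹ distance).
[cite: Balaban1984PropagatorsII, (2.46) p.231; Balaban1984PropagatorsI, (1.110) p.35] -/
theorem exp_rate_distSite_le_exp_pl1 (s : ℕ) [NeZero s] {r : ℝ} (hr : 0 ≤ r)
    (y c : Tor (fun _ : Fin (d + 1) => s)) :
    Real.exp (-(r * distSite (fun _ : Fin (d + 1) => s) y c)) ≤
      Real.exp (-(r / ((d : ℝ) + 1)) * pl1 (y - c)) := by
  apply Real.exp_le_exp.mpr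
  have hb := pl1_sub_le_mul_distSite s y c
  have hρ : 0 ≤ r / ((d : ℝ) + 1) := div_nonneg hr (by positivity)
  have hmul := mul_le_mul_of_nonneg_left hb hρ
  have e : r / ((d : ℝ) + 1) * (((d : ℝ) + 1) * distSite (fun _ : Fin (d + 1) => s) y c) =
      r * distSite (fun _ : Fin (d + 1) => s) y c := by
    field_simp
  rw [e] at hmul
  linarith

/-- **The displacement of a same-block pair**: `nm·y + a₂ = (nm·y + a₁) + (a₂ − a₁)‾` on the fine torus.
[cite: Balaban1984PropagatorsI, (1.6) p.18] [folklore] -/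
theorem bpt_eq_bpt_add_toT (nm : ℕ) [NeZero nm] (P : Fin (d + 1) → ℕ) [∀ i, NeZero (P i)] (y : Tor P)
    (a₁ a₂ : Fin (d + 1) → Fin nm) :
    bpt nm P y a₂ = bpt nm P y a₁ + toT (fine nm P) (fun i => ((a₂ i : ℕ) : ℤ) - ((a₁ i : ℕ) : ℤ)) := by
  funext i
  simp only [bpt, Pi.add_apply, iota, toT]
  push_cast
  ring

/-- Distinct offsets give a non-zero displacement (hence a positive length `‖a₂ − a₁‖₂`). [folklore]
[cite: Balaban1984PropagatorsI, (1.6) p.18] -/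
theorem disp_ne_zero {nm : ℕ} {a₁ a₂ : Fin (d + 1) → Fin nm} (h : a₁ ≠ a₂) :
    (fun i => ((a₂ i : ℕ) : ℤ) - ((a₁ i : ℕ) : ℤ)) ≠ 0 := by
  intro h0
  apply h
  funext i
  have hi := congrFun h0 i
  simp only [Pi.zero_apply, sub_eq_zero, Nat.cast_inj] at hi
  exact (Fin.ext hi).symm

end Helpers

/-! ## 2. The row majorant of the extended operator `(H_k, ∇^ηH_k, Hölder quotients)` -/

section RowMajorant

variable (n : ℕ) [NeZero n] (s : ℕ) [NeZero s]

/-- **THE ROW MAJORANT OF `(H_k, ∇^ηH_k, |·|^{−α}-QUOTIENTS OF ∇^ηH_k)`** on the cubic torus family (mesh `η = 1∕n`,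
unit torus with `s` sites per direction, `D = d + 1`, `0 ≤ α < 1`): for every coarse 1-form `B`, every `(y, μ)` and
every entry label `e`, `‖(extended column)((y,μ),e)‖ ≤ Σ_{(c,λ)} Cα·e^{−(ρα∕D)‖y − c‖}·‖B_λ(c)‖` with
`Cα = max(max(CH0,CH1)(D), CHD(d,α))`, `ρα = rateH(D)·(1−α)∕(1+α)` — value: [3] (2.151) first entry
(`norm_HkOp_bpt_le`); gradient: second entry (`norm_dker_bpt_le'`); Hölder quotient of a same-block pair: the decaying
Hölder letter `norm_dker_sub_le_decay'` (the factor `(‖a₂−a₁‖₂∕n)^α` cancels the weight; rate `(1−α)∕(1+α)` of the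
value rate), distances converted by §1.
[cite: Balaban1984PropagatorsII, Cor. 2.8 (2.151) p.249, (2.51) p.232; Balaban1984PropagatorsI, (1.63) p.28, p.29 lines 1–2, (1.6) p.18] -/
theorem rowMajorant_HkOpC1a {α : ℝ} (hα0 : 0 ≤ α) (hα1 : α < 1)
    (B : Tor (fun _ : Fin (d + 1) => s) × Fin (d + 1) → ℂ)
    (q : (Tor (fun _ : Fin (d + 1) => s) × Fin (d + 1)) ×
      ((Fin (d + 1) → Fin n) ⊕ (((Fin (d + 1) → Fin n) × Fin (d + 1)) ⊕
        (((Fin (d + 1) → Fin n) × (Fin (d + 1) → Fin n)) × Fin (d + 1))))) :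
    ‖(Matrix.of (fun (q : (Tor (fun _ : Fin (d + 1) => s) × Fin (d + 1)) ×
          ((Fin (d + 1) → Fin n) ⊕ (((Fin (d + 1) → Fin n) × Fin (d + 1)) ⊕
            (((Fin (d + 1) → Fin n) × (Fin (d + 1) → Fin n)) × Fin (d + 1)))))
          (b : Tor (fun _ : Fin (d + 1) => s) × Fin (d + 1)) =>
          q.2.elim (fun a => hker n (fun _ : Fin (d + 1) => s) q.1.2 b.2 (bpt n (fun _ : Fin (d + 1) => s) q.1.1 a) b.1)
            (fun e => e.elim
              (fun aν => dker n (fun _ : Fin (d + 1) => s) q.1.2 b.2 aν.2 (bpt n (fun _ : Fin (d + 1) => s) q.1.1 aν.1) b.1)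
              (fun w => (dker n (fun _ : Fin (d + 1) => s) q.1.2 b.2 w.2 (bpt n (fun _ : Fin (d + 1) => s) q.1.1 w.1.2) b.1 -
                  dker n (fun _ : Fin (d + 1) => s) q.1.2 b.2 w.2 (bpt n (fun _ : Fin (d + 1) => s) q.1.1 w.1.1) b.1) *
                (((zlen (fun i => ((w.1.2 i : ℕ) : ℤ) - ((w.1.1 i : ℕ) : ℤ)) / (n : ℝ)) ^ α)⁻¹ : ℝ)))) *ᵥ B) q‖ ≤
      ∑ b : Tor (fun _ : Fin (d + 1) => s) × Fin (d + 1),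
        max (max (CH0 (d + 1)) (CH1 (d + 1))) (CHD d α) *
          Real.exp (-(rateH (d + 1) * ((1 - α) / (1 + α)) / ((d : ℝ) + 1)) * pl1 (q.1.1 - b.1)) * ‖B b‖ := by
  obtain ⟨⟨y, μ⟩, e⟩ := q
  rw [Matrix.mulVec, dotProduct]
  refine (norm_sum_le _ _).trans (Finset.sum_le_sum fun b _ => ?_)
  rw [norm_mul]
  refine mul_le_mul_of_nonneg_right ?_ (norm_nonneg _)
  obtain ⟨c, lam⟩ := b
  set Cα : ℝ := max (max (CH0 (d + 1)) (CH1 (d + 1))) (CHD d α) with hCα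
  set θ' : ℝ := (1 - α) / (1 + α) with hθ'
  have hθ'0 : 0 ≤ θ' := div_nonneg (by linarith) (by linarith)
  have hθ'1 : θ' ≤ 1 := by rw [hθ', div_le_one (by linarith)]; linarith
  have hC0 : 0 ≤ Cα := le_max_of_le_left (le_max_of_le_left (CH0_nonneg d))
  have hr0 : 0 ≤ rateH (d + 1) * θ' := mul_nonneg (rateH_pos d).le hθ'0
  -- the common decay factor at the Hölder rate dominates the value ∕ gradient factor `EH`
  have hEH : EH (fun _ : Fin (d + 1) => s) y c ≤ Real.exp (-(rateH (d + 1) * θ' * distSite (fun _ : Fin (d + 1) => s) y c)) := by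
    unfold EH
    apply Real.exp_le_exp.mpr
    have hds : 0 ≤ distSite (fun _ : Fin (d + 1) => s) y c := distSite_nonneg y c
    have : rateH (d + 1) * θ' * distSite (fun _ : Fin (d + 1) => s) y c ≤ rateH (d + 1) * 1 * distSite (fun _ : Fin (d + 1) => s) y c :=
      mul_le_mul_of_nonneg_right (mul_le_mul_of_nonneg_left hθ'1 (rateH_pos d).le) hds
    linarith
  have hconv := exp_rate_distSite_le_exp_pl1 s hr0 y c
  -- the entry bound `≤ Cα · e^{−rateH·θ′·distSite}`
  have hentry : ‖(Matrix.of (fun (q : (Tor (fun _ : Fin (d + 1) => s) × Fin (d + 1)) ×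
          ((Fin (d + 1) → Fin n) ⊕ (((Fin (d + 1) → Fin n) × Fin (d + 1)) ⊕
            (((Fin (d + 1) → Fin n) × (Fin (d + 1) → Fin n)) × Fin (d + 1)))))
          (b : Tor (fun _ : Fin (d + 1) => s) × Fin (d + 1)) =>
          q.2.elim (fun a => hker n (fun _ : Fin (d + 1) => s) q.1.2 b.2 (bpt n (fun _ : Fin (d + 1) => s) q.1.1 a) b.1)
            (fun e => e.elim (fun aν => dker n (fun _ : Fin (d + 1) => s) q.1.2 b.2 aν.2 (bpt n (fun _ : Fin (d + 1) => s) q.1.1 aν.1) b.1)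
              (fun w => (dker n (fun _ : Fin (d + 1) => s) q.1.2 b.2 w.2 (bpt n (fun _ : Fin (d + 1) => s) q.1.1 w.1.2) b.1 - dker n (fun _ : Fin (d + 1) => s) q.1.2 b.2 w.2 (bpt n (fun _ : Fin (d + 1) => s) q.1.1 w.1.1) b.1) *
                (((zlen (fun i => ((w.1.2 i : ℕ) : ℤ) - ((w.1.1 i : ℕ) : ℤ)) / (n : ℝ)) ^ α)⁻¹ : ℝ))))) ((y, μ), e) (c, lam)‖ ≤
      Cα * Real.exp (-(rateH (d + 1) * θ' * distSite (fun _ : Fin (d + 1) => s) y c)) := by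
    rw [Matrix.of_apply]
    rcases e with a | aν | w
    · -- value entry
      have h := norm_HkOp_bpt_le n (fun _ : Fin (d + 1) => s) y c a μ lam
      simp only [Sum.elim_inl]
      refine h.trans ?_
      exact mul_le_mul (le_max_of_le_left (le_max_left _ _)) hEH (Real.exp_pos _).le hC0
    · rcases aν with ⟨a, ν⟩
      have h := norm_dker_bpt_le' n (fun _ : Fin (d + 1) => s) y c a μ lam ν
      simp only [Sum.elim_inr, Sum.elim_inl]
      refine h.trans ?_
      exact mul_le_mul (le_max_of_le_left (le_max_right _ _)) hEH (Real.exp_pos _).le hC0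
    · rcases w with ⟨⟨a₁, a₂⟩, ν⟩
      simp only [Sum.elim_inr]
      set z : Fin (d + 1) → ℤ := fun i => ((a₂ i : ℕ) : ℤ) - ((a₁ i : ℕ) : ℤ) with hz_def
      set wgt : ℝ := (zlen z / (n : ℝ)) ^ α with hw_def
      have hCHD : CHD d α ≤ Cα := le_max_right _ _
      have hexp0 : 0 ≤ Real.exp (-(rateH (d + 1) * θ' * distSite (fun _ : Fin (d + 1) => s) y c)) := (Real.exp_pos _).le
      by_cases ha : a₁ = a₂
      · subst ha
        rw [sub_self, zero_mul, norm_zero]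
        exact mul_nonneg hC0 hexp0
      · have hz0 : z ≠ 0 := disp_ne_zero ha
        have hzl : 0 < zlen z := zlen_pos hz0
        have hn : (0 : ℝ) < n := by exact_mod_cast Nat.pos_of_ne_zero (NeZero.ne n)
        have hw : 0 < wgt := Real.rpow_pos_of_pos (div_pos hzl hn) _
        -- the decaying Hölder letter at the pair `(nm·y + a₁, nm·y + a₂)`
        have hpair : bpt n (fun _ : Fin (d + 1) => s) (toT (fun _ : Fin (d + 1) => s) (rep (fun _ : Fin (d + 1) => s) y)) a₂ = bpt n (fun _ : Fin (d + 1) => s) (toT (fun _ : Fin (d + 1) => s) (rep (fun _ : Fin (d + 1) => s) y)) a₁ + toT (fine n (fun _ : Fin (d + 1) => s)) z := by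
          rw [toT_rep]; exact bpt_eq_bpt_add_toT n (fun _ : Fin (d + 1) => s) y a₁ a₂
        have h := norm_dker_sub_le_decay' n (fun _ : Fin (d + 1) => s) μ lam ν (rep (fun _ : Fin (d + 1) => s) y) (rep (fun _ : Fin (d + 1) => s) y) (rep (fun _ : Fin (d + 1) => s) c) a₁ a₂ z hpair hα0 hα1
        rw [toT_rep, toT_rep, min_self, ← distSite_eq_torusSupNorm, ← rateH_succ_eq] at h
        rw [norm_mul, Complex.norm_real, Real.norm_eq_abs, abs_of_pos (inv_pos.mpr hw)]
        rw [← hθ', ← hw_def] at h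
        calc ‖dker n (fun _ : Fin (d + 1) => s) μ lam ν (bpt n (fun _ : Fin (d + 1) => s) y a₂) c - dker n (fun _ : Fin (d + 1) => s) μ lam ν (bpt n (fun _ : Fin (d + 1) => s) y a₁) c‖ * wgt⁻¹
            ≤ (CHD d α * wgt * Real.exp (-(rateH (d + 1) * θ' * distSite (fun _ : Fin (d + 1) => s) y c))) * wgt⁻¹ :=
              mul_le_mul_of_nonneg_right h (inv_pos.mpr hw).le
          _ = CHD d α * Real.exp (-(rateH (d + 1) * θ' * distSite (fun _ : Fin (d + 1) => s) y c)) := by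
              field_simp
          _ ≤ Cα * Real.exp (-(rateH (d + 1) * θ' * distSite (fun _ : Fin (d + 1) => s) y c)) :=
              mul_le_mul_of_nonneg_right hCHD hexp0
  refine hentry.trans ?_
  have e2 : -(rateH (d + 1) * ((1 - α) / (1 + α)) / ((d : ℝ) + 1)) * pl1 (y - c) =
      -(rateH (d + 1) * θ' / ((d : ℝ) + 1)) * pl1 (y - c) := by rw [hθ']
  rw [e2]
  exact mul_le_mul_of_nonneg_left hconv hC0

end RowMajorant

/-! ## 3. NODE D's socket inhabited by `(H_k, ∇^ηH_k, Hölder quotients)`; ONE constant record for all steps and volumes -/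

section Socket

variable {Mc : ℕ} [NeZero Mc] {N : ℕ → ℕ} [∀ n, NeZero (N n)]

/-- **NODE D's SOCKET `Data190` INHABITED BY `(H_k, ∇^ηH_k, HÖLDER QUOTIENTS)`** on the extended two-grid carrier
(B-data = coarse 1-forms `T₁ × Fin D → ℂ`; configurations = `(T₁ × Fin D) × Entry → ℂ` with the sup norm = the maximum
of the value, gradient and same-block Hölder-quotient sizes; δ sources `δ_{(y,μ₀)}`; row majorant = §2): for
`0 ≤ α < 1` and under the NUMERICS `0 < q.σ`, `c₀(q.σ∕δr)^D ≤ q.cR`, `1 ≤ q.κB`, `q.δ15 ≤ 4·ρα∕D`,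
`Cα·D·K₁(D, ρα∕(2D)) ≤ q.Cst`, `1 ≤ q.m`, `0 ≤ q.θ`, `q.θ·M ≤ 1` (`ρα = rateH(D)(1−α)∕(1+α)`,
`Cα = max(max(CH0,CH1),CHD)`) — for EVERY mesh `nm`, volume sequence `N`, direction `μ₀`:
`∃ 𝒟 : Data190 D M N (fun n => (T₁(n) × Fin D) × Entry → ℂ) q` with
`𝒟.hn n X̄ y = (q ↦ cube(q.1.1) ∈ X̄ ? (extended column at δ_{(y,μ₀)})(q) : 0)`.
[cite: Balaban1987RG1, p.282, (4.35) p.290, (4.4) p.281; Balaban1984PropagatorsII, Cor. 2.8 (2.151) p.249, (2.61) p.234; Balaban1984PropagatorsI, p.29 lines 1–2; Balaban1985Variational, (190) p.308] -/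
theorem exists_data190_twoGrid_HkOpC1a (I : Type) (i₀ : I) (η L Mg R : ℕ → ℝ) (H : ℕ → Prop)
    (nm : ℕ) [NeZero nm] (μ₀ : Fin (d + 1)) {α : ℝ} (hα0 : 0 ≤ α) (hα1 : α < 1) {q : Consts190} {δr : ℝ}
    (hδr : 0 < δr) (hσ₀ : 0 < q.σ) (hcR : B6.c0 δr (q.σ / δr) ^ (d + 1) ≤ q.cR) (hκB : 1 ≤ q.κB)
    (hδ15 : q.δ15 ≤ 4 * (rateH (d + 1) * ((1 - α) / (1 + α)) / ((d : ℝ) + 1)))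
    (hCst : max (max (CH0 (d + 1)) (CH1 (d + 1))) (CHD d α) * ((d + 1 : ℕ) : ℝ) *
      K₁ (d + 1) (rateH (d + 1) * ((1 - α) / (1 + α)) / ((d : ℝ) + 1) / 2) ≤ q.Cst)
    (hm1 : 1 ≤ q.m) (hθ : 0 ≤ q.θ) (hθM : q.θ * Mc ≤ 1) :
    ∃ 𝒟 : Data190 (d + 1) Mc N
        (fun n => (Tor (fun _ : Fin (d + 1) => N n * Mc) × Fin (d + 1)) ×
          ((Fin (d + 1) → Fin nm) ⊕ (((Fin (d + 1) → Fin nm) × Fin (d + 1)) ⊕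
            (((Fin (d + 1) → Fin nm) × (Fin (d + 1) → Fin nm)) × Fin (d + 1)))) → ℂ) q,
      ∀ (n : ℕ) (X : TDom (d + 1) (N n)) (y : TPt (d + 1) (N n * Mc)),
        𝒟.hn n X y = fun q : (Tor (fun _ : Fin (d + 1) => N n * Mc) × Fin (d + 1)) ×
            ((Fin (d + 1) → Fin nm) ⊕ (((Fin (d + 1) → Fin nm) × Fin (d + 1)) ⊕
            (((Fin (d + 1) → Fin nm) × (Fin (d + 1) → Fin nm)) × Fin (d + 1)))) =>
          if tcubeOf (N n) Mc q.1.1 ∈ X.1 then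
            ((Matrix.of (fun (q : (Tor (fun _ : Fin (d + 1) => N n * Mc) × Fin (d + 1)) ×
                ((Fin (d + 1) → Fin nm) ⊕ (((Fin (d + 1) → Fin nm) × Fin (d + 1)) ⊕
            (((Fin (d + 1) → Fin nm) × (Fin (d + 1) → Fin nm)) × Fin (d + 1)))))
                (b : Tor (fun _ : Fin (d + 1) => N n * Mc) × Fin (d + 1)) =>
                q.2.elim (fun a => hker nm (fun _ : Fin (d + 1) => N n * Mc) q.1.2 b.2 (bpt nm (fun _ : Fin (d + 1) => N n * Mc) q.1.1 a) b.1)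
                  (fun e => e.elim
                    (fun aν => dker nm (fun _ : Fin (d + 1) => N n * Mc) q.1.2 b.2 aν.2 (bpt nm (fun _ : Fin (d + 1) => N n * Mc) q.1.1 aν.1) b.1)
                    (fun w => (dker nm (fun _ : Fin (d + 1) => N n * Mc) q.1.2 b.2 w.2 (bpt nm (fun _ : Fin (d + 1) => N n * Mc) q.1.1 w.1.2) b.1 -
                        dker nm (fun _ : Fin (d + 1) => N n * Mc) q.1.2 b.2 w.2 (bpt nm (fun _ : Fin (d + 1) => N n * Mc) q.1.1 w.1.1) b.1) *
                      (((zlen (fun i => ((w.1.2 i : ℕ) : ℤ) - ((w.1.1 i : ℕ) : ℤ)) / (nm : ℝ)) ^ α)⁻¹ : ℝ))))) *ᵥ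
              (Pi.single (y, μ₀) (1 : ℂ))) q
          else 0 :=
  exists_data190_twoGrid_of_rowMajorant I i₀ η L Mg R H
    (fun n => Tor (fun _ : Fin (d + 1) => N n * Mc) × Fin (d + 1))
    (fun n => (Tor (fun _ : Fin (d + 1) => N n * Mc) × Fin (d + 1)) ×
      ((Fin (d + 1) → Fin nm) ⊕ (((Fin (d + 1) → Fin nm) × Fin (d + 1)) ⊕
            (((Fin (d + 1) → Fin nm) × (Fin (d + 1) → Fin nm)) × Fin (d + 1)))))
    (fun n (b : Tor (fun _ : Fin (d + 1) => N n * Mc) × Fin (d + 1)) => b.1)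
    (fun n (q : (Tor (fun _ : Fin (d + 1) => N n * Mc) × Fin (d + 1)) ×
      ((Fin (d + 1) → Fin nm) ⊕ (((Fin (d + 1) → Fin nm) × Fin (d + 1)) ⊕
            (((Fin (d + 1) → Fin nm) × (Fin (d + 1) → Fin nm)) × Fin (d + 1))))) => q.1.1)
    (fun n (y : TPt (d + 1) (N n * Mc)) => (y, μ₀)) (fun _ _ => rfl) (d + 1)
    (fun n y => (card_fibre_fst (β := Fin (d + 1)) y).le.trans (by rw [Fintype.card_fin]))
    (fun n => ((Matrix.of (fun (q : (Tor (fun _ : Fin (d + 1) => N n * Mc) × Fin (d + 1)) ×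
                ((Fin (d + 1) → Fin nm) ⊕ (((Fin (d + 1) → Fin nm) × Fin (d + 1)) ⊕
            (((Fin (d + 1) → Fin nm) × (Fin (d + 1) → Fin nm)) × Fin (d + 1)))))
                (b : Tor (fun _ : Fin (d + 1) => N n * Mc) × Fin (d + 1)) =>
                q.2.elim (fun a => hker nm (fun _ : Fin (d + 1) => N n * Mc) q.1.2 b.2 (bpt nm (fun _ : Fin (d + 1) => N n * Mc) q.1.1 a) b.1)
                  (fun e => e.elim
                    (fun aν => dker nm (fun _ : Fin (d + 1) => N n * Mc) q.1.2 b.2 aν.2 (bpt nm (fun _ : Fin (d + 1) => N n * Mc) q.1.1 aν.1) b.1)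
                    (fun w => (dker nm (fun _ : Fin (d + 1) => N n * Mc) q.1.2 b.2 w.2 (bpt nm (fun _ : Fin (d + 1) => N n * Mc) q.1.1 w.1.2) b.1 -
                        dker nm (fun _ : Fin (d + 1) => N n * Mc) q.1.2 b.2 w.2 (bpt nm (fun _ : Fin (d + 1) => N n * Mc) q.1.1 w.1.1) b.1) *
                      (((zlen (fun i => ((w.1.2 i : ℕ) : ℤ) - ((w.1.1 i : ℕ) : ℤ)) / (nm : ℝ)) ^ α)⁻¹ : ℝ))))).mulVecLin).restrictScalars ℝ)
    (le_max_of_le_left (le_max_of_le_left (CH0_nonneg d)))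
    (div_pos (mul_pos (rateH_pos d) (div_pos (by linarith) (by linarith))) (by positivity))
    (fun n B q => rowMajorant_HkOpC1a nm (N n * Mc) hα0 hα1 B q)
    hδr hσ₀ hcR hκB hδ15 hCst hm1 hθ hθM

/-- **ONE CONSTANT RECORD FOR ALL STEPS AND VOLUMES, value ∕ gradient ∕ Hölder entries** (`0 ≤ α < 1`): with
`ρα := rateH(D)·(1−α)∕(1+α)∕D` and the explicit record `q⋆α = ⟨Cst := Cα·D·K₁(D, ρα∕2), δ15 := 4ρα, σ := ρα∕4,
τ := ρα∕4, cR := c₀(ρα, ¼)^D, m := 1, θ := 1∕M, κB := 1⟩` one has `q⋆α.Valid (ρα∕(4M))` AND, for every mesh `nm`,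
volume sequence `N`, direction `μ₀` (every index set of (4.4)-sizes, every geometry weights), NODE D's socket inhabited
by `(H_k, ∇^ηH_k, Hölder quotients)` with THIS `q⋆α`.
[cite: Balaban1987RG1, p.282, (4.4) p.281, (5.10) p.293; Balaban1985Variational, (190) p.308; Balaban1984PropagatorsII, Cor. 2.8 (2.151) p.249, Lemma 2.1 (2.61) p.234; Balaban1984PropagatorsI, p.29 lines 1–2] -/
theorem exists_consts190_twoGrid_HkOpC1a (d Mc : ℕ) [NeZero Mc] {α : ℝ} (hα0 : 0 ≤ α) (hα1 : α < 1) :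
    ∃ q : Consts190, q.Valid (rateH (d + 1) * ((1 - α) / (1 + α)) / ((d : ℝ) + 1) / (4 * Mc)) ∧
      ∀ (I : Type) (_ : I) (η L Mg R : ℕ → ℝ) (H : ℕ → Prop) (N : ℕ → ℕ) [∀ n, NeZero (N n)]
        (nm : ℕ) [NeZero nm] (μ₀ : Fin (d + 1)),
        ∃ 𝒟 : Data190 (d + 1) Mc N
            (fun n => (Tor (fun _ : Fin (d + 1) => N n * Mc) × Fin (d + 1)) ×
              ((Fin (d + 1) → Fin nm) ⊕ (((Fin (d + 1) → Fin nm) × Fin (d + 1)) ⊕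
            (((Fin (d + 1) → Fin nm) × (Fin (d + 1) → Fin nm)) × Fin (d + 1)))) → ℂ) q,
          ∀ (n : ℕ) (X : TDom (d + 1) (N n)) (y : TPt (d + 1) (N n * Mc)),
            𝒟.hn n X y = fun q : (Tor (fun _ : Fin (d + 1) => N n * Mc) × Fin (d + 1)) ×
                ((Fin (d + 1) → Fin nm) ⊕ (((Fin (d + 1) → Fin nm) × Fin (d + 1)) ⊕
            (((Fin (d + 1) → Fin nm) × (Fin (d + 1) → Fin nm)) × Fin (d + 1)))) =>
              if tcubeOf (N n) Mc q.1.1 ∈ X.1 then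
                ((Matrix.of (fun (q : (Tor (fun _ : Fin (d + 1) => N n * Mc) × Fin (d + 1)) ×
                ((Fin (d + 1) → Fin nm) ⊕ (((Fin (d + 1) → Fin nm) × Fin (d + 1)) ⊕
            (((Fin (d + 1) → Fin nm) × (Fin (d + 1) → Fin nm)) × Fin (d + 1)))))
                (b : Tor (fun _ : Fin (d + 1) => N n * Mc) × Fin (d + 1)) =>
                q.2.elim (fun a => hker nm (fun _ : Fin (d + 1) => N n * Mc) q.1.2 b.2 (bpt nm (fun _ : Fin (d + 1) => N n * Mc) q.1.1 a) b.1)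
                  (fun e => e.elim
                    (fun aν => dker nm (fun _ : Fin (d + 1) => N n * Mc) q.1.2 b.2 aν.2 (bpt nm (fun _ : Fin (d + 1) => N n * Mc) q.1.1 aν.1) b.1)
                    (fun w => (dker nm (fun _ : Fin (d + 1) => N n * Mc) q.1.2 b.2 w.2 (bpt nm (fun _ : Fin (d + 1) => N n * Mc) q.1.1 w.1.2) b.1 -
                        dker nm (fun _ : Fin (d + 1) => N n * Mc) q.1.2 b.2 w.2 (bpt nm (fun _ : Fin (d + 1) => N n * Mc) q.1.1 w.1.1) b.1) *
                      (((zlen (fun i => ((w.1.2 i : ℕ) : ℤ) - ((w.1.1 i : ℕ) : ℤ)) / (nm : ℝ)) ^ α)⁻¹ : ℝ))))) *ᵥ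
                  (Pi.single (y, μ₀) (1 : ℂ))) q
              else 0 := by
  set ρ : ℝ := rateH (d + 1) * ((1 - α) / (1 + α)) / ((d : ℝ) + 1) with hρ_def
  have hρ : 0 < ρ := div_pos (mul_pos (rateH_pos d) (div_pos (by linarith) (by linarith))) (by positivity)
  have hMc : (0 : ℝ) < Mc := by exact_mod_cast Nat.pos_of_ne_zero (NeZero.ne Mc)
  have hc0 : 0 ≤ B6.c0 ρ (1 / 4) := by unfold B6.c0; exact tsum_nonneg fun z => (Real.exp_pos _).le
  have hC : 0 ≤ max (max (CH0 (d + 1)) (CH1 (d + 1))) (CHD d α) :=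
    le_max_of_le_left (le_max_of_le_left (CH0_nonneg d))
  refine ⟨⟨max (max (CH0 (d + 1)) (CH1 (d + 1))) (CHD d α) * ((d + 1 : ℕ) : ℝ) * K₁ (d + 1) (ρ / 2), 4 * ρ,
    ρ / 4, ρ / 4, B6.c0 ρ (1 / 4) ^ (d + 1), 1, 1 / Mc, 1⟩, ?_, ?_⟩
  · refine ⟨?_, ?_, zero_le_one, zero_le_one, by positivity, ?_, ?_⟩
    · exact mul_nonneg (mul_nonneg hC (Nat.cast_nonneg _)) (K₁_nonneg _ _)
    · exact pow_nonneg hc0 _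
    · show ρ / 4 + ρ / 4 ≤ 4 * ρ / 8
      linarith
    · show rateH (d + 1) * ((1 - α) / (1 + α)) / ((d : ℝ) + 1) / (4 * Mc) ≤ ρ / 4 * (1 / Mc)
      rw [← hρ_def]
      have e : ρ / (4 * Mc) = ρ / 4 * (1 / Mc) := by field_simp
      rw [e]
  · intro I i₀ η L Mg R H N _ nm _ μ₀
    refine exists_data190_twoGrid_HkOpC1a I i₀ η L Mg R H nm μ₀ hα0 hα1 (δr := ρ) hρ
      (by show 0 < ρ / 4; positivity) ?_ le_rfl ?_ ?_ le_rfl ?_ ?_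
    · show B6.c0 ρ (ρ / 4 / ρ) ^ (d + 1) ≤ B6.c0 ρ (1 / 4) ^ (d + 1)
      have e : ρ / 4 / ρ = 1 / 4 := by field_simp
      rw [e]
    · show 4 * ρ ≤ 4 * (rateH (d + 1) * ((1 - α) / (1 + α)) / ((d : ℝ) + 1))
      rw [← hρ_def]
    · show max (max (CH0 (d + 1)) (CH1 (d + 1))) (CHD d α) * ((d + 1 : ℕ) : ℝ) *
          K₁ (d + 1) (rateH (d + 1) * ((1 - α) / (1 + α)) / ((d : ℝ) + 1) / 2) ≤
        max (max (CH0 (d + 1)) (CH1 (d + 1))) (CHD d α) * ((d + 1 : ℕ) : ℝ) * K₁ (d + 1) (ρ / 2)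
      rw [← hρ_def]
    · show (0 : ℝ) ≤ 1 / Mc
      positivity
    · show 1 / (Mc : ℝ) * Mc ≤ 1
      rw [one_div_mul_cancel hMc.ne']

end Socket

/-! ## 4. NODE E on the extended carrier: every entry converges as the volume grows -/

section NodeE

/-- **THE KERNEL OF `∂^η_νH_k` CONVERGES ENTRYWISE AS THE VOLUME GROWS** on the cubic tori of the leaf lists
(`P_n = (N n·M, …)`, `N n → ∞`): `∂_νH_k((nm·x̄′ + a, μ), (x̄, λ)) → latticeKernel (D163 nm μ λ ν a) (x′ − x)`
(`B5Hk163TorusHolderDecay.dker_bpt` + `dgker_toT_eq_torusKernel` + `RemainderDecay190TwoGridHkLimit.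
tendsto_torusKernel_descend` with `stripRegular_D163`). [cite: Balaban1984PropagatorsI, p.29, (1.63) p.28, p.36; Balaban1987RG1, (1.21) p.264, (5.10) p.293] [folklore] -/
theorem tendsto_dker_bpt_cubes (nm : ℕ) [NeZero nm] (μ lam ν : Fin (d + 1)) (a : Fin (d + 1) → Fin nm)
    {N : ℕ → ℕ} [∀ n, NeZero (N n)] {Mc : ℕ} [NeZero Mc] (hN : Tendsto N atTop atTop)
    (x' x : Fin (d + 1) → ℤ) :
    Tendsto (fun n => dker nm (fun _ : Fin (d + 1) => N n * Mc) μ lam ν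
        (bpt nm (fun _ : Fin (d + 1) => N n * Mc) (toT (fun _ : Fin (d + 1) => N n * Mc) x') a)
        (toT (fun _ : Fin (d + 1) => N n * Mc) x)) atTop
      (𝓝 (latticeKernel (fun p : Fin (d + 1) → ℂ => D163 nm μ lam ν a p) (x' - x))) := by
  have hP : ∀ i : Fin (d + 1), Tendsto (fun n => (fun _ : Fin (d + 1) => N n * Mc) i) atTop atTop := fun _ =>
    tendsto_atTop_mono (fun n => Nat.le_mul_of_pos_right (N n) (Nat.pos_of_neZero Mc)) hN
  have hP1 : ∀ (n : ℕ) (i : Fin (d + 1)), 1 ≤ (fun _ : Fin (d + 1) => N n * Mc) i := fun n i =>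
    Nat.one_le_iff_ne_zero.mpr (NeZero.ne _)
  refine (tendsto_torusKernel_descend (stripRegular_D163 nm μ lam ν a) (kappa163_pos _)
    (P := fun n => (fun _ : Fin (d + 1) => N n * Mc)) hP1 hP (x' - x)).congr fun n => ?_
  rw [dker_bpt, toT_sub, dgker_toT_eq_torusKernel]

/-- **Every extended entry converges**: for every entry label `e`, the extended matrix entry between the row
`((x̄′, μ), e)` and the coarse bond `(x̄, λ)` converges to the corresponding expression in the infinite-lattice kernels
`latticeKernel G_a (x′ − x)`, `latticeKernel D_{ν,a} (x′ − x)` (value ∕ gradient ∕ weighted same-block difference).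
[cite: Balaban1987RG1, (1.21) p.264; Balaban1984PropagatorsI, (1.63) p.28, p.29, p.36] [folklore] -/
theorem tendsto_entryC1a_cubes (nm : ℕ) [NeZero nm] (μ lam : Fin (d + 1)) (α : ℝ)
    (e : ((Fin (d + 1) → Fin nm) ⊕ (((Fin (d + 1) → Fin nm) × Fin (d + 1)) ⊕
            (((Fin (d + 1) → Fin nm) × (Fin (d + 1) → Fin nm)) × Fin (d + 1)))))
    {N : ℕ → ℕ} [∀ n, NeZero (N n)] {Mc : ℕ} [NeZero Mc] (hN : Tendsto N atTop atTop)
    (x' x : Fin (d + 1) → ℤ) :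
    Tendsto (fun n =>
      (Matrix.of (fun (q : (Tor (fun _ : Fin (d + 1) => N n * Mc) × Fin (d + 1)) ×
                ((Fin (d + 1) → Fin nm) ⊕ (((Fin (d + 1) → Fin nm) × Fin (d + 1)) ⊕
            (((Fin (d + 1) → Fin nm) × (Fin (d + 1) → Fin nm)) × Fin (d + 1)))))
                (b : Tor (fun _ : Fin (d + 1) => N n * Mc) × Fin (d + 1)) =>
                q.2.elim (fun a => hker nm (fun _ : Fin (d + 1) => N n * Mc) q.1.2 b.2 (bpt nm (fun _ : Fin (d + 1) => N n * Mc) q.1.1 a) b.1)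
                  (fun e => e.elim
                    (fun aν => dker nm (fun _ : Fin (d + 1) => N n * Mc) q.1.2 b.2 aν.2 (bpt nm (fun _ : Fin (d + 1) => N n * Mc) q.1.1 aν.1) b.1)
                    (fun w => (dker nm (fun _ : Fin (d + 1) => N n * Mc) q.1.2 b.2 w.2 (bpt nm (fun _ : Fin (d + 1) => N n * Mc) q.1.1 w.1.2) b.1 -
                        dker nm (fun _ : Fin (d + 1) => N n * Mc) q.1.2 b.2 w.2 (bpt nm (fun _ : Fin (d + 1) => N n * Mc) q.1.1 w.1.1) b.1) *
                      (((zlen (fun i => ((w.1.2 i : ℕ) : ℤ) - ((w.1.1 i : ℕ) : ℤ)) / (nm : ℝ)) ^ α)⁻¹ : ℝ)))))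
        ((toT (fun _ : Fin (d + 1) => N n * Mc) x', μ), e) (toT (fun _ : Fin (d + 1) => N n * Mc) x, lam)) atTop
      (𝓝 (e.elim (fun a => latticeKernel (fun p : Fin (d + 1) → ℂ => G163 nm μ lam a p) (x' - x))
        (fun e' => e'.elim
          (fun aν => latticeKernel (fun p : Fin (d + 1) → ℂ => D163 nm μ lam aν.2 aν.1 p) (x' - x))
          (fun w => (latticeKernel (fun p : Fin (d + 1) → ℂ => D163 nm μ lam w.2 w.1.2 p) (x' - x) -
              latticeKernel (fun p : Fin (d + 1) → ℂ => D163 nm μ lam w.2 w.1.1 p) (x' - x)) *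
            (((zlen (fun i => ((w.1.2 i : ℕ) : ℤ) - ((w.1.1 i : ℕ) : ℤ)) / (nm : ℝ)) ^ α)⁻¹ : ℝ))))) := by
  rcases e with a | aν | w
  · simp only [Matrix.of_apply, Sum.elim_inl]
    exact tendsto_hker_bpt_cubes nm μ lam a hN x' x
  · rcases aν with ⟨a, ν⟩
    simp only [Matrix.of_apply, Sum.elim_inr, Sum.elim_inl]
    exact tendsto_dker_bpt_cubes nm μ lam ν a hN x' x
  · rcases w with ⟨⟨a₁, a₂⟩, ν⟩
    simp only [Matrix.of_apply, Sum.elim_inr]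
    exact ((tendsto_dker_bpt_cubes nm μ lam ν a₂ hN x' x).sub
      (tendsto_dker_bpt_cubes nm μ lam ν a₁ hN x' x)).mul_const _

variable {Mc : ℕ} [NeZero Mc] {N : ℕ → ℕ} [∀ n, NeZero (N n)] {q : Consts190}

/-- **[I] (1.21) FOR `(H_k, ∇^ηH_k, Hölder quotients)` ON THE EXTENDED TWO-GRID CARRIER.**  For ANY (190)-socket `𝒟`
over `Wn n := (T₁(n) × Fin D) × Entry → ℂ` with the computation rule of §3 (`hrule`), any window of finitely many
labelled coarse lattice points `((x′_i, μ_i), e_i)` with `x′_i` inside the cubes of `Y` (`he`), and `N n → ∞`: the window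
read-out of the test vectors converges to the corresponding window column of the infinite-lattice kernels — the field
`hconv` of `PolLeavesTFac190` with `V Y := ι Y → ℂ`, `r n Y :=` the product of coordinate projections at the labelled
window points (displayed), `t Y x :=` the limit column.
[cite: Balaban1987RG1, (1.21) p.264, (4.35) p.290, (4.4) p.281, (5.10) p.293; Balaban1984PropagatorsI, (1.63) p.28, p.29, p.36] [folklore] -/
theorem hconv_twoGrid_HkOpC1a_of_rule (nm : ℕ) [NeZero nm] (μ₀ : Fin (d + 1)) (α : ℝ)
    (D : Data190 (d + 1) Mc N
      (fun n => (Tor (fun _ : Fin (d + 1) => N n * Mc) × Fin (d + 1)) ×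
        ((Fin (d + 1) → Fin nm) ⊕ (((Fin (d + 1) → Fin nm) × Fin (d + 1)) ⊕
            (((Fin (d + 1) → Fin nm) × (Fin (d + 1) → Fin nm)) × Fin (d + 1)))) → ℂ) q)
    (hrule : ∀ (n : ℕ) (X : TDom (d + 1) (N n)) (y : TPt (d + 1) (N n * Mc)),
      D.hn n X y = fun q : (Tor (fun _ : Fin (d + 1) => N n * Mc) × Fin (d + 1)) ×
          ((Fin (d + 1) → Fin nm) ⊕ (((Fin (d + 1) → Fin nm) × Fin (d + 1)) ⊕
            (((Fin (d + 1) → Fin nm) × (Fin (d + 1) → Fin nm)) × Fin (d + 1)))) =>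
        if tcubeOf (N n) Mc q.1.1 ∈ X.1 then
          ((Matrix.of (fun (q : (Tor (fun _ : Fin (d + 1) => N n * Mc) × Fin (d + 1)) ×
                ((Fin (d + 1) → Fin nm) ⊕ (((Fin (d + 1) → Fin nm) × Fin (d + 1)) ⊕
            (((Fin (d + 1) → Fin nm) × (Fin (d + 1) → Fin nm)) × Fin (d + 1)))))
                (b : Tor (fun _ : Fin (d + 1) => N n * Mc) × Fin (d + 1)) =>
                q.2.elim (fun a => hker nm (fun _ : Fin (d + 1) => N n * Mc) q.1.2 b.2 (bpt nm (fun _ : Fin (d + 1) => N n * Mc) q.1.1 a) b.1)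
                  (fun e => e.elim
                    (fun aν => dker nm (fun _ : Fin (d + 1) => N n * Mc) q.1.2 b.2 aν.2 (bpt nm (fun _ : Fin (d + 1) => N n * Mc) q.1.1 aν.1) b.1)
                    (fun w => (dker nm (fun _ : Fin (d + 1) => N n * Mc) q.1.2 b.2 w.2 (bpt nm (fun _ : Fin (d + 1) => N n * Mc) q.1.1 w.1.2) b.1 -
                        dker nm (fun _ : Fin (d + 1) => N n * Mc) q.1.2 b.2 w.2 (bpt nm (fun _ : Fin (d + 1) => N n * Mc) q.1.1 w.1.1) b.1) *
                      (((zlen (fun i => ((w.1.2 i : ℕ) : ℤ) - ((w.1.1 i : ℕ) : ℤ)) / (nm : ℝ)) ^ α)⁻¹ : ℝ))))) *ᵥ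
            (Pi.single (y, μ₀) (1 : ℂ))) q
        else 0)
    (hN : Tendsto N atTop atTop) {ι : LDom (d + 1) → Type} [∀ Y, Fintype (ι Y)]
    (ex : (Y : LDom (d + 1)) → ι Y → Pt (d + 1)) (eμ : (Y : LDom (d + 1)) → ι Y → Fin (d + 1))
    (ee : (Y : LDom (d + 1)) → ι Y →
      ((Fin (d + 1) → Fin nm) ⊕ (((Fin (d + 1) → Fin nm) × Fin (d + 1)) ⊕
            (((Fin (d + 1) → Fin nm) × (Fin (d + 1) → Fin nm)) × Fin (d + 1)))))
    (he : ∀ Y i, cubeOf Mc (ex Y i) ∈ Y.1) :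
    ∀ (Y : LDom (d + 1)) (x : Pt (d + 1)),
      Tendsto (fun n =>
        (ContinuousLinearMap.pi fun i : ι Y =>
            ContinuousLinearMap.proj (R := ℂ)
              (φ := fun _ : (Tor (fun _ : Fin (d + 1) => N n * Mc) × Fin (d + 1)) ×
                ((Fin (d + 1) → Fin nm) ⊕ (((Fin (d + 1) → Fin nm) × Fin (d + 1)) ⊕
            (((Fin (d + 1) → Fin nm) × (Fin (d + 1) → Fin nm)) × Fin (d + 1)))) => ℂ)
              ((proj (N n * Mc) (ex Y i), eμ Y i), ee Y i))
          (D.hn n (tproj (N n) Y) (proj (N n * Mc) x))) atTop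
        (𝓝 fun i => ((ee Y i).elim (fun a => latticeKernel (fun p : Fin (d + 1) → ℂ => G163 nm (eμ Y i) μ₀ a p) (ex Y i - x))
        (fun e' => e'.elim
          (fun aν => latticeKernel (fun p : Fin (d + 1) → ℂ => D163 nm (eμ Y i) μ₀ aν.2 aν.1 p) (ex Y i - x))
          (fun w => (latticeKernel (fun p : Fin (d + 1) → ℂ => D163 nm (eμ Y i) μ₀ w.2 w.1.2 p) (ex Y i - x) -
              latticeKernel (fun p : Fin (d + 1) → ℂ => D163 nm (eμ Y i) μ₀ w.2 w.1.1 p) (ex Y i - x)) *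
            (((zlen (fun i => ((w.1.2 i : ℕ) : ℤ) - ((w.1.1 i : ℕ) : ℤ)) / (nm : ℝ)) ^ α)⁻¹ : ℝ))))) := by
  intro Y x
  refine tendsto_pi_nhds.2 fun i => ?_
  refine (tendsto_entryC1a_cubes nm (eμ Y i) μ₀ α (ee Y i) (Mc := Mc) hN (ex Y i) x).congr fun n => ?_
  rw [ContinuousLinearMap.pi_apply, ContinuousLinearMap.proj_apply, hrule]
  dsimp only
  rw [if_pos (tcubeOf_proj_mem_tproj Y (he Y i)), Matrix.mulVec_single_one]
  rfl

/-- **NODE D ∧ NODE E FOR `(H_k, ∇^ηH_k, Hölder quotients)`, ONE CONSTANT RECORD FOR ALL STEPS AND VOLUMES**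
(`0 ≤ α < 1`; §3 + this section: the fields `D` and `hconv` of `RemainderDecay190.PolLeavesTFac190` for Bałaban's flat
linearized minimizer with the value, gradient and Hölder entries, hypothesis-free).
[cite: Balaban1987RG1, p.282, (1.21) p.264, (4.35) p.290, (4.4) p.281; Balaban1984PropagatorsI, (1.63) p.28, p.29, p.36; Balaban1984PropagatorsII, Cor. 2.8 (2.151) p.249; Balaban1985Variational, (190) p.308] -/
theorem exists_data190_hconv_twoGrid_HkOpC1a (d Mc : ℕ) [NeZero Mc] {α : ℝ} (hα0 : 0 ≤ α) (hα1 : α < 1) :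
    ∃ q : Consts190, q.Valid (rateH (d + 1) * ((1 - α) / (1 + α)) / ((d : ℝ) + 1) / (4 * Mc)) ∧
      ∀ (I : Type) (_ : I) (η L Mg R : ℕ → ℝ) (H : ℕ → Prop) (N : ℕ → ℕ) [∀ n, NeZero (N n)]
        (_ : Tendsto N atTop atTop) (nm : ℕ) [NeZero nm] (μ₀ : Fin (d + 1)),
        ∃ 𝒟 : Data190 (d + 1) Mc N
            (fun n => (Tor (fun _ : Fin (d + 1) => N n * Mc) × Fin (d + 1)) ×
              ((Fin (d + 1) → Fin nm) ⊕ (((Fin (d + 1) → Fin nm) × Fin (d + 1)) ⊕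
            (((Fin (d + 1) → Fin nm) × (Fin (d + 1) → Fin nm)) × Fin (d + 1)))) → ℂ) q,
          (∀ (n : ℕ) (X : TDom (d + 1) (N n)) (y : TPt (d + 1) (N n * Mc)),
            𝒟.hn n X y = fun q : (Tor (fun _ : Fin (d + 1) => N n * Mc) × Fin (d + 1)) ×
                ((Fin (d + 1) → Fin nm) ⊕ (((Fin (d + 1) → Fin nm) × Fin (d + 1)) ⊕
            (((Fin (d + 1) → Fin nm) × (Fin (d + 1) → Fin nm)) × Fin (d + 1)))) =>
              if tcubeOf (N n) Mc q.1.1 ∈ X.1 then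
                ((Matrix.of (fun (q : (Tor (fun _ : Fin (d + 1) => N n * Mc) × Fin (d + 1)) ×
                ((Fin (d + 1) → Fin nm) ⊕ (((Fin (d + 1) → Fin nm) × Fin (d + 1)) ⊕
            (((Fin (d + 1) → Fin nm) × (Fin (d + 1) → Fin nm)) × Fin (d + 1)))))
                (b : Tor (fun _ : Fin (d + 1) => N n * Mc) × Fin (d + 1)) =>
                q.2.elim (fun a => hker nm (fun _ : Fin (d + 1) => N n * Mc) q.1.2 b.2 (bpt nm (fun _ : Fin (d + 1) => N n * Mc) q.1.1 a) b.1)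
                  (fun e => e.elim
                    (fun aν => dker nm (fun _ : Fin (d + 1) => N n * Mc) q.1.2 b.2 aν.2 (bpt nm (fun _ : Fin (d + 1) => N n * Mc) q.1.1 aν.1) b.1)
                    (fun w => (dker nm (fun _ : Fin (d + 1) => N n * Mc) q.1.2 b.2 w.2 (bpt nm (fun _ : Fin (d + 1) => N n * Mc) q.1.1 w.1.2) b.1 -
                        dker nm (fun _ : Fin (d + 1) => N n * Mc) q.1.2 b.2 w.2 (bpt nm (fun _ : Fin (d + 1) => N n * Mc) q.1.1 w.1.1) b.1) *
                      (((zlen (fun i => ((w.1.2 i : ℕ) : ℤ) - ((w.1.1 i : ℕ) : ℤ)) / (nm : ℝ)) ^ α)⁻¹ : ℝ))))) *ᵥ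
                  (Pi.single (y, μ₀) (1 : ℂ))) q
              else 0) ∧
          ∀ {ι : LDom (d + 1) → Type} [∀ Y, Fintype (ι Y)] (ex : (Y : LDom (d + 1)) → ι Y → Pt (d + 1))
            (eμ : (Y : LDom (d + 1)) → ι Y → Fin (d + 1))
            (ee : (Y : LDom (d + 1)) → ι Y →
              ((Fin (d + 1) → Fin nm) ⊕ (((Fin (d + 1) → Fin nm) × Fin (d + 1)) ⊕
            (((Fin (d + 1) → Fin nm) × (Fin (d + 1) → Fin nm)) × Fin (d + 1)))))
            (_ : ∀ Y i, cubeOf Mc (ex Y i) ∈ Y.1) (Y : LDom (d + 1)) (x : Pt (d + 1)),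
            Tendsto (fun n =>
              (ContinuousLinearMap.pi fun i : ι Y =>
                  ContinuousLinearMap.proj (R := ℂ)
                    (φ := fun _ : (Tor (fun _ : Fin (d + 1) => N n * Mc) × Fin (d + 1)) ×
                      ((Fin (d + 1) → Fin nm) ⊕ (((Fin (d + 1) → Fin nm) × Fin (d + 1)) ⊕
            (((Fin (d + 1) → Fin nm) × (Fin (d + 1) → Fin nm)) × Fin (d + 1)))) => ℂ)
                    ((proj (N n * Mc) (ex Y i), eμ Y i), ee Y i))
                (𝒟.hn n (tproj (N n) Y) (proj (N n * Mc) x))) atTop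
              (𝓝 fun i => ((ee Y i).elim (fun a => latticeKernel (fun p : Fin (d + 1) → ℂ => G163 nm (eμ Y i) μ₀ a p) (ex Y i - x))
        (fun e' => e'.elim
          (fun aν => latticeKernel (fun p : Fin (d + 1) → ℂ => D163 nm (eμ Y i) μ₀ aν.2 aν.1 p) (ex Y i - x))
          (fun w => (latticeKernel (fun p : Fin (d + 1) → ℂ => D163 nm (eμ Y i) μ₀ w.2 w.1.2 p) (ex Y i - x) -
              latticeKernel (fun p : Fin (d + 1) → ℂ => D163 nm (eμ Y i) μ₀ w.2 w.1.1 p) (ex Y i - x)) *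
            (((zlen (fun i => ((w.1.2 i : ℕ) : ℤ) - ((w.1.1 i : ℕ) : ℤ)) / (nm : ℝ)) ^ α)⁻¹ : ℝ))))) := by
  obtain ⟨q, hq, h⟩ := exists_consts190_twoGrid_HkOpC1a d Mc hα0 hα1
  refine ⟨q, hq, fun I i₀ η L Mg R H N _ hN nm _ μ₀ => ?_⟩
  obtain ⟨𝒟, hrule⟩ := h I i₀ η L Mg R H N nm μ₀
  exact ⟨𝒟, hrule, fun ex eμ ee he Y x => hconv_twoGrid_HkOpC1a_of_rule nm μ₀ α 𝒟 hrule hN ex eμ ee he Y x⟩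

end NodeE

end

end Literature.MathematicalPhysics.QuantumFieldTheory.Balaban1983to89.Beta.RemainderDecay190TwoGridHkHolder
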